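import Mathlib
import Summits.CriticalPhenomena.CardyFormulaZ2.Theorems.CardyMagicRigidityNestingRigiditySiteTranslation
import Summits.CriticalPhenomena.CardyFormulaZ2.Theorems.CardyMagicRigidityNestingRigidityUVExpMomentsDilation
import Summits.CriticalPhenomena.CardyFormulaZ2.Theorems.CardyMagicRigidityNestingRigidityBigLoopsFirstMoment
import HarnessLib

/-!
# Crux `NestingRigidity`, line `positive-cone-weight-doubling`: keystone K6 at ALL CENTRES and
# ALL SCALES, both lattices (one constant)

Crux `Summit.CriticalPhenomena.CardyFormulaZ2.Theses.CardyMagicRigidity.NestingRigidity`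
(stmt-CriticalPhenomena-4835), line `positive-cone-weight-doubling`, registered helper Ξ₂
`uvFarBiteSq_expMoment_latticeEnsembles` (first brick of the multi-scale wave: the cell bound of
the dyadic decomposition of the UV statistics needs the all-order exponential moments of the
number of big loops in a window centred ANYWHERE, at every dyadic scale, with ONE constant).

* §1 counts of loops confined to a ball of any centre are finite, bounded and exponentially
  integrable at a fixed mesh (`…BigLoopsFirstMoment` §1, recentred); the big-loop predicate under
  a translation of the loop family (`ncard_bigLoops_image_translate`);
* §2 **K6 at all centres and scales** (`expMoment_ncard_bigLoops_le_ball_scale`): for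
  `E ∈ latticeEnsembles`, `s R η` (`0 < η ≤ R`) there are `C, c₀ > 0` with
  `E_δ[exp(s · #{u ∈ X_δ | trace ⊆ B(x, λR), diam ≥ λη})] ≤ C` for ALL `x ∈ ℂ`, `λ > 0`,
  `0 < δ`, `c₀ δ ≤ λη`.  Proof: move `x` to a `2δ`-close law-preserving translation vector `b`
  (`SiteTranslation.exists_near_translate_loops_latticeEnsembles`: `δℤ²`, resp. `δ𝕋`, translations
  transport the loop sets of `zEns`, resp. `tEns`, and preserve `P_{1/2}`), enlarge the window
  `B(x, λR) ⊆ B(b, λ(R + 2η))` (monotonicity of the count, `s ≥ 0` after `s ↦ max(s,0)`), and apply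
  K6 at all scales at centre `0` (`expMoment_ncard_bigLoops_le_scale`, exact dilation covariance);
* §3 the registered anchor `expMoment_ncard_bigLoops_le_ball` (window `B(x, 2ρ)`, diameter `≥ ρ`,
  all `ρ ≥ c₀δ`), the form quoted in the briefs of the wave.
-/

noncomputable section

open MeasureTheory Set Filter Metric
open scoped Real Topology BigOperators

namespace Summit.CriticalPhenomena.CardyFormulaZ2.Cruxes.NestingRigidity.PositiveConeWeightDoubling

open Literature.Probability.RandomPlanarGeometry Literature.Probability.Percolation
  Literature.Probability.LatticeModels
open Summit.CriticalPhenomena.CardyFormulaZ2.Cruxes.NestingRigidity.RingCloudTomography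
open Summit.CriticalPhenomena.CardyFormulaZ2.Cruxes.NestingRigidity.MarkovCascadeOneGeneration
  (continuous_translate isometry_translate range_map_translate)

namespace BigLoopsBall

/-- The translation `z ↦ z + b` of the plane as a continuous map (local notation, not a
definition). -/
local notation3 "T[" b "]" => (⟨fun z : ℂ ↦ 1 * z + (b : ℂ), continuous_translate b⟩ : C(ℂ, ℂ))

/-! ## §1 Loop counts in balls of any centre; the big-loop predicate under translation -/

/-- A ball of any centre lies in a ball about the origin. -/
theorem ball_subset_ball_zero (x : ℂ) (ρ : ℝ) : ball x ρ ⊆ ball (0 : ℂ) (‖x‖ + ρ) := fun z hz ↦ by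
  rw [mem_ball, dist_eq_norm] at hz
  rw [mem_ball, dist_zero_right]
  calc ‖z‖ = ‖z - x + x‖ := by rw [sub_add_cancel]
    _ ≤ ‖z - x‖ + ‖x‖ := norm_add_le _ _
    _ < ‖x‖ + ρ := by linarith

/-- On both lattice ensembles, at a fixed mesh `δ > 0`, the loops confined to a ball `B(x, ρ)` cut
out by any further predicate form a finite set of deterministically bounded cardinality. -/
theorem exists_ncard_loops_sep_le_ball : ∀ E ∈ latticeEnsembles, ∀ {δ : ℝ}, 0 < δ → ∀ (x : ℂ) (ρ : ℝ),
    ∃ N : ℕ, ∀ (Q : UnbasedLoop ℂ → Prop), (∀ u, Q u → u.range ⊆ ball x ρ) →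
      ∀ ω : E.Ω, {u ∈ (E.X δ ω).loops | Q u}.Finite ∧ {u ∈ (E.X δ ω).loops | Q u}.ncard ≤ N := by
  intro E hE δ hδ x ρ
  obtain ⟨N, hN⟩ := BigLoops.exists_ncard_loops_sep_le E hE hδ (‖x‖ + ρ)
  exact ⟨N, fun Q hQ ω ↦ hN Q (fun u hu ↦ (hQ u hu).trans (ball_subset_ball_zero x ρ)) ω⟩

/-- On both lattice ensembles, at a fixed mesh `δ > 0`, `exp(a · #{loops confined to B(x, ρ), Q})` is
integrable for every real `a`. -/
theorem integrable_exp_mul_ncard_loops_sep : ∀ E ∈ latticeEnsembles, ∀ {δ : ℝ}, 0 < δ →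
    ∀ (x : ℂ) (ρ a : ℝ) (Q : UnbasedLoop ℂ → Prop), (∀ u, Q u → u.range ⊆ ball x ρ) →
      Integrable (fun ω ↦ Real.exp (a * ({u ∈ (E.X δ ω).loops | Q u}.ncard : ℝ))) E.P := by
  intro E hE δ hδ x ρ a Q hQ
  haveI := isProbabilityMeasure_of_mem hE
  obtain ⟨N, hN⟩ := exists_ncard_loops_sep_le_ball E hE hδ x ρ
  have hmeas : Measurable fun ω ↦ ({u ∈ (E.X δ ω).loops | Q u}.ncard : ℝ) :=
    measurable_from_nat.comp (BigLoops.measurable_ncard_loops_sep E hE δ Q)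
  refine Integrable.of_bound (Real.measurable_exp.comp (hmeas.const_mul a)).aestronglyMeasurable
    (Real.exp (|a| * N)) (Eventually.of_forall fun ω ↦ ?_)
  rw [Real.norm_eq_abs, Real.abs_exp]
  refine Real.exp_le_exp.2 ?_
  have h1 : ({u ∈ (E.X δ ω).loops | Q u}.ncard : ℝ) ≤ N := by exact_mod_cast (hN Q hQ ω).2
  have h2 : (0 : ℝ) ≤ ({u ∈ (E.X δ ω).loops | Q u}.ncard : ℝ) := Nat.cast_nonneg _
  calc a * ({u ∈ (E.X δ ω).loops | Q u}.ncard : ℝ)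
      ≤ |a| * ({u ∈ (E.X δ ω).loops | Q u}.ncard : ℝ) := mul_le_mul_of_nonneg_right (le_abs_self a) h2
    _ ≤ |a| * N := mul_le_mul_of_nonneg_left h1 (abs_nonneg a)

/-- **The big-loop predicate under translation**: the translate `u + b` has trace in `B(b, ρ)` and
diameter `≥ η` iff `u` has trace in `B(0, ρ)` and diameter `≥ η`. -/
theorem bigLoop_translate_iff (b : ℂ) (ρ η : ℝ) (u : UnbasedLoop ℂ) :
    ((UnbasedLoop.map T[b] (isometry_translate b) u).range ⊆ ball b ρ ∧
        η ≤ diam (UnbasedLoop.map T[b] (isometry_translate b) u).range) ↔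
      (u.range ⊆ ball (0 : ℂ) ρ ∧ η ≤ diam u.range) := by
  have hiso : Isometry fun z : ℂ ↦ z + b := Isometry.of_dist_eq fun x y ↦ by simp [dist_eq_norm]
  have hpre : (fun z : ℂ ↦ z + b) ⁻¹' ball b ρ = ball 0 ρ := by
    ext z; simp [mem_ball, dist_eq_norm]
  rw [range_map_translate, hiso.diam_image, Set.image_subset_iff, hpre]

/-- **Counting big loops in a translated family**: the translates by `b` of a loop family `L` contain
as many loops with trace in `B(b, ρ)` and diameter `≥ η` as `L` contains loops with trace in
`B(0, ρ)` and diameter `≥ η`. -/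
theorem ncard_bigLoops_image_translate (b : ℂ) (L : Set (UnbasedLoop ℂ)) (ρ η : ℝ) :
    {u ∈ UnbasedLoop.map T[b] (isometry_translate b) '' L | u.range ⊆ ball b ρ ∧ η ≤ diam u.range}.ncard =
      {u ∈ L | u.range ⊆ ball (0 : ℂ) ρ ∧ η ≤ diam u.range}.ncard :=
  BondTranslation.ncard_sep_image_translate b L _ _ fun u ↦ bigLoop_translate_iff b ρ η u

end BigLoopsBall

open BigLoopsBall in
/-- **Keystone K6 at ALL CENTRES and ALL SCALES, both lattice ensembles** (helper toward Ξ₂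
`uvFarBiteSq_expMoment_latticeEnsembles`, line `positive-cone-weight-doubling`): for
`E ∈ latticeEnsembles` and all `s R η` (`0 < η ≤ R`) there are `C, c₀ > 0` such that for EVERY centre
`x ∈ ℂ`, every scale `λ > 0` and every mesh `0 < δ` with `c₀ δ ≤ λη`, the number of loops of `X_δ`
with trace in `B(x, λR)` and diameter `≥ λη` has `E_δ[exp(s · #)] ≤ C` (integrability included).
Proof: `x` is `2δ`-close to a law-preserving translation vector `b`
(`SiteTranslation.exists_near_translate_loops_latticeEnsembles`); the count only grows when the
window `B(x, λR)` is replaced by `B(b, λ(R + 2η)) ⊇ B(x, λR)` (`2δ ≤ 2λη`); the law of the latter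
count is that of the count in `B(0, λ(R + 2η))` (`ncard_bigLoops_image_translate`), bounded by K6
at all scales `expMoment_ncard_bigLoops_le_scale` (order `max(s, 0)`). -/
theorem expMoment_ncard_bigLoops_le_ball_scale : ∀ E ∈ latticeEnsembles, ∀ (s R η : ℝ), 0 < η → η ≤ R →
    ∃ C c₀ : ℝ, 0 < C ∧ 0 < c₀ ∧ ∀ (x : ℂ) (l δ : ℝ), 0 < l → 0 < δ → c₀ * δ ≤ l * η →
      Integrable (fun ω ↦ Real.exp (s * ({u ∈ (E.X δ ω).loops |
        u.range ⊆ Metric.ball x (l * R) ∧ l * η ≤ Metric.diam u.range}.ncard : ℝ))) E.P ∧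
      ∫ ω, Real.exp (s * ({u ∈ (E.X δ ω).loops |
        u.range ⊆ Metric.ball x (l * R) ∧ l * η ≤ Metric.diam u.range}.ncard : ℝ)) ∂E.P ≤ C := by
  intro E hE s R η hη hηR
  haveI := isProbabilityMeasure_of_mem hE
  obtain ⟨C, c₀, hC, hc₀, h⟩ :=
    expMoment_ncard_bigLoops_le_scale E hE (max s 0) (R + 2 * η) η hη (by linarith)
  refine ⟨C, max c₀ 1, hC, by positivity, fun x l δ hl hδ hcδ ↦ ?_⟩
  have hc₀δ : c₀ * δ ≤ l * η := le_trans (mul_le_mul_of_nonneg_right (le_max_left _ _) hδ.le) hcδ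
  have hδl : δ ≤ l * η := le_trans (by nlinarith [le_max_right c₀ 1]) hcδ
  obtain ⟨b, hxb, hlaw⟩ := SiteTranslation.exists_near_translate_loops_latticeEnsembles E hE hδ x
  have hball : ball x (l * R) ⊆ ball b (l * (R + 2 * η)) :=
    ball_subset_ball' (by nlinarith [dist_comm x b])
  have hint : ∀ (a : ℝ) (y : ℂ) (ρ : ℝ), Integrable (fun ω ↦ Real.exp (a * ({u ∈ (E.X δ ω).loops |
      u.range ⊆ ball y ρ ∧ l * η ≤ diam u.range}.ncard : ℝ))) E.P := fun a y ρ ↦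
    integrable_exp_mul_ncard_loops_sep E hE hδ y ρ a _ fun _ hu ↦ hu.1
  refine ⟨hint s x (l * R), ?_⟩
  obtain ⟨N, hN⟩ := exists_ncard_loops_sep_le_ball E hE hδ b (l * (R + 2 * η))
  have hfin : ∀ ω, {u ∈ (E.X δ ω).loops | u.range ⊆ ball b (l * (R + 2 * η)) ∧
      l * η ≤ diam u.range}.Finite := fun ω ↦ (hN _ (fun _ hu ↦ hu.1) ω).1
  -- the law of the count in `B(b, λ(R + 2η))` is the law of the count in `B(0, λ(R + 2η))`
  have hlaw' := hlaw fun L ↦ Real.exp (max s 0 * ({u ∈ L |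
    u.range ⊆ ball b (l * (R + 2 * η)) ∧ l * η ≤ diam u.range}.ncard : ℝ))
  simp only [ncard_bigLoops_image_translate] at hlaw'
  calc ∫ ω, Real.exp (s * ({u ∈ (E.X δ ω).loops |
          u.range ⊆ ball x (l * R) ∧ l * η ≤ diam u.range}.ncard : ℝ)) ∂E.P
      ≤ ∫ ω, Real.exp (max s 0 * ({u ∈ (E.X δ ω).loops |
          u.range ⊆ ball x (l * R) ∧ l * η ≤ diam u.range}.ncard : ℝ)) ∂E.P :=
        integral_mono (hint s x _) (hint _ x _) fun ω ↦
          Real.exp_le_exp.2 (mul_le_mul_of_nonneg_right (le_max_left _ _) (Nat.cast_nonneg _))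
    _ ≤ ∫ ω, Real.exp (max s 0 * ({u ∈ (E.X δ ω).loops |
          u.range ⊆ ball b (l * (R + 2 * η)) ∧ l * η ≤ diam u.range}.ncard : ℝ)) ∂E.P := by
        refine integral_mono (hint _ x _) (hint _ b _) fun ω ↦ Real.exp_le_exp.2
          (mul_le_mul_of_nonneg_left ?_ (le_max_right _ _))
        have hsub : {u ∈ (E.X δ ω).loops | u.range ⊆ ball x (l * R) ∧ l * η ≤ diam u.range} ⊆
            {u ∈ (E.X δ ω).loops | u.range ⊆ ball b (l * (R + 2 * η)) ∧ l * η ≤ diam u.range} :=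
          fun u hu ↦ ⟨hu.1, hu.2.1.trans hball, hu.2.2⟩
        exact_mod_cast ncard_le_ncard hsub (hfin ω)
    _ = ∫ ω, Real.exp (max s 0 * ({u ∈ (E.X δ ω).loops |
          u.range ⊆ ball (0 : ℂ) (l * (R + 2 * η)) ∧ l * η ≤ diam u.range}.ncard : ℝ)) ∂E.P :=
        hlaw'.symm
    _ ≤ C := (h l δ hl hδ hc₀δ).2

/-- **Keystone K6 at all centres, both lattices** (registered anchor toward Ξ₂
`uvFarBiteSq_expMoment_latticeEnsembles`, line `positive-cone-weight-doubling`; the form quoted in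
the briefs of the wave): for `E ∈ latticeEnsembles` and every real order `s` there are `C, c₀ > 0`
such that for EVERY centre `x ∈ ℂ`, every radius `ρ` and every mesh `0 < δ` with `c₀ δ ≤ ρ`, the
number of loops of `X_δ` with trace in `B(x, 2ρ)` and diameter `≥ ρ` has `E_δ[exp(s · #)] ≤ C`
(`expMoment_ncard_bigLoops_le_ball_scale` with `R = 2`, `η = 1`, `λ = ρ`). -/
theorem expMoment_ncard_bigLoops_le_ball : ∀ E ∈ latticeEnsembles, ∀ (s : ℝ), ∃ C c₀ : ℝ, 0 < C ∧ 0 < c₀ ∧ ∀ (x : ℂ) (ρ δ : ℝ), 0 < δ → c₀ * δ ≤ ρ →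
      ∫ ω, Real.exp (s * ({u ∈ (E.X δ ω).loops | u.range ⊆ Metric.ball x (2 * ρ) ∧ ρ ≤ Metric.diam u.range}.ncard : ℝ)) ∂E.P ≤ C := by
  intro E hE s
  obtain ⟨C, c₀, hC, hc₀, h⟩ := expMoment_ncard_bigLoops_le_ball_scale E hE s 2 1 one_pos (by norm_num)
  refine ⟨C, c₀, hC, hc₀, fun x ρ δ hδ hcδ ↦ ?_⟩
  have hρ : 0 < ρ := lt_of_lt_of_le (mul_pos hc₀ hδ) hcδ
  have h' := (h x ρ δ hρ hδ (by rwa [mul_one])).2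
  rw [mul_one, mul_comm ρ 2] at h'
  exact h'

/-- The same with integrability, for convenience of the cell bounds of the wave. -/
theorem integrable_expMoment_ncard_bigLoops_ball : ∀ E ∈ latticeEnsembles, ∀ (s : ℝ) (x : ℂ) (ρ η δ : ℝ),
    0 < δ → Integrable (fun ω ↦ Real.exp (s * ({u ∈ (E.X δ ω).loops |
      u.range ⊆ Metric.ball x ρ ∧ η ≤ Metric.diam u.range}.ncard : ℝ))) E.P :=
  fun E hE s x ρ _ _ hδ ↦
    BigLoopsBall.integrable_exp_mul_ncard_loops_sep E hE hδ x ρ s _ fun _ hu ↦ hu.1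

end Summit.CriticalPhenomena.CardyFormulaZ2.Cruxes.NestingRigidity.PositiveConeWeightDoubling

end
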